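import Summits.ResolutionOfSingularities.ResolutionOfSingularities.Theorems.MarkedTransferCampaignW36SingLCIBridge
import HarnessLib

/-!
# [OURS · L1 W3.6 ↔ GAP-LEDGER R20 sub 20a] THE TWO CARRIERS OF THE 20a SPLIT, BY NAME: the class-level OURS Prop
# `CampaignW36.Thm614Part1On 𝒞` («Th. 6.14 (1) at EVERY typed core focus of every realized member of the class 𝒞»), its `p`-slices in the
# readings R1 / R2 of the produced edge data, the binder-free POSITIVE on `RegularClosureClass` (20a's FOLLOWS-half = p493712 ∘ p498576), and the
# generic SEAT-1 composition «door ∧ P ∧ (56″) ∧ Th. 6.14 (2″)» on `LCIClass`-data (carrier of 20a's DNF-half once SEAT 1 certifies its cross)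

Cell `res-hironaka` (run/shared/lean/pub/res-hironaka/), rung L (rescue), row L-G3, slot W3.6 ↔ GAP-LEDGER R20. Typed by the OURS typer o4 (statement-only
lane); third file of the series p498576 `…W36SingRegularBridge` (⟨HatClosureRegular⟩ ⟺ ⟨SingRegular(Ě)⟩, class `RegularClosureClass`) / p499800
`…W36SingLCIBridge` (`LCIClass` guard = the (56″)/(2″) kernels' `hci`; `campaignW36_eq56_thm614prop2_lci_holds`). HOST (custody, no new route):
`--supports stmt-ResolutionOfSingularities-16155 --as helper`.

WHY (records on the cell's STATUS.md): res-adj-3 GAP-AMEND R20 (2/2) 2026-08-27T05:15:49Z (C) words 20a (Th. 6.14 (1) at the (43)-object) as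
FOLLOWS-MODULO-⟨SingRegular(Ě)⟩ with the «EQUIVALENT PHRASING: 20a FOLLOWS, binder-free, for every typed core focus of every (A,E,ed) in
`CampaignW36.RegularClosureClass` (o4 (1) + p493712 `Thm6_14_1_of_isRegular_sing`)», and RE-CITE 05:18:01Z (B) / GO 05:23:16Z ask for exactly this file
«AS SHAPED» from the shelf draft 52f6e7fb07e255c2: a class-level HYPOTHESIS-shape Prop whose `RegularClosureClass` instance is a THEOREM (20a's
FOLLOWS-half BY NAME) and whose negation on `LCIClass` at `𝔽₂` — after SEAT 1 (s36-pv-3 := res-D-pv-034) certifies the l.c.i. cross and proves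
«∀ typed core focus Ě of that Ê, ¬Thm6_14_1 at the cross point» Literature-side — will be 20a's DNF-half BY NAME; neither line is a modulus of a G3 word
(rule 04:12:28Z). Reading slots (rider R3 of 04:56:11Z, accepted 05:23:16Z without reshape): row 040a's `Thm6_14_1 A n IsCoreFocusOf E Ě hE hĚ IsEdgeData`
has an UNREAD guard slot `IsCoreFocusOf` — instantiated here at the instantiation of record `IsCoreFocus ℘ (invInst Ê ed)` (so `hĚ` IS
`IsCoreFocus_inst Ê Ě ed`) — and a READING `IsEdgeData'` of the PRODUCED edge data, kept a PARAMETER exactly as p493712 does (`hread : R1 ∧ R2 ⇒ IsEdgeData'`);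
the provenance `IsEdgeData` of the INPUT family `ed` is the separate W3.6 class-idiom parameter. A `Literature.*` module cannot import `Summits.*`, so the
door's ∃ (p491140) meets SEAT 1's ∀-over-`Ě` negative only here: `exists_coreFocus_inst_of_lciClass`.
* §1 `CampaignW36.Thm614Part1On 𝒞 IsEdgeData IsEdgeData'` (def), `thm614Part1On_regularClosureClass (hread)` (20a ✓ on regular top strata, ANY input
  provenance, ANY reading implied by R1 ∧ R2), `thm614Part1On_of_hatClosureRegularOn` (same on p498576's `HatClosureRegularOn 𝒞`-data),
  `thm614Part1On_mono`.
* §2 slices `CampaignW36Thm614Part1OnI 𝒞 p` (input provenance R1 = `CampaignW31.edgeDataProvenance`, conclusion read R1) and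
  `CampaignW36Thm614Part1OnR2I 𝒞 p` (conclusion read R2 = `S04CharAlgebra.edgeDataProvenance_alg`, row 007g, the R2 sibling of the R1 adapter), both UNCONDITIONAL on `RegularClosureClass`;
  the generic SEAT-1 composition `exists_coreFocus_inst_of_lciClass` (door p491140 + p499800's (56″)/(2″), any property `P` of all typed core foci).

HONEST FRAMING. Every declaration below is OURS (a campaign statement about OUR typed objects) or kernel plumbing over typed carriers; NOTHING here
is a statement of H. Hironaka's manuscript (2017-03-23, [Hironaka2017], lit key `paper:url-3343fd9e678b`), nothing asserts that Th. 6.14 (1) p.34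
l.11–17 holds or fails as printed; `Thm6_14_1` is row 040a's TYPED CANDIDATE (res-type-040), consumed as the body of a class predicate; regularity /
l.c.i. guards on `Σ̄_max` are printed nowhere in §6. The typed candidates `IsCoreFocus(_inst)`, `baseHike`, `EdgeDataOn`, `IsEdgeDataOn`, `invField` /
`invInst`, `S04CharAlgebra.pAlg`, `IsEdgeData`, `IsEdgeData_alg` are carriers / hypotheses / readings only. AI typing, weaker than expert review.

## Vacuity self-check (T-lint; for the lanes)
* `Thm614Part1On 𝒞 …` / the two slices: NOT trivially true — on `𝒞 = LCIClass` it is pre-declared to FAIL at SEAT 1's cross (embedded codimension of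
  `Σ̄_max` jumps 2 → 1; UNCERTIFIED today); NOT trivially false — ✓ on `RegularClosureClass` (this file). The inner `Thm6_14_1` quantifies over
  `ξ ∈ Ě.sing`, so at an `Ě` with EMPTY singular locus it holds vacuously (disclosed; for `0 < Ê.b` the door's `Ě` has `Sing(Ě) = Σ̄_max ≠ ∅`,
  p485977's `baseHike_sing_inter_closedPoints_nonempty`). Vacuous exactly where the Hat family is (no standard `E` with `0 < Ê.b` in the class).
* `exists_coreFocus_inst_of_lciClass` demands an actual `Ě` and an actual `P Ě`; with `P := fun _ => True` it is p499800's headline.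

Reference (context only, not a premise): H. Hironaka, ms. 2017-03-23, §6.3 Th. 6.14 (1) p.34 l.11–17; §6.2 Eq. (43) p.30 l.4–9. [Hironaka2017]
-/

noncomputable section

set_option linter.dupNamespace false -- mandated namespace of this single-conjunct summit

open _root_.AlgebraicGeometry _root_.TopologicalSpace

namespace Summit.ResolutionOfSingularities.ResolutionOfSingularities.Theorems

open Literature.AlgebraicGeometry.Resolution Literature.AlgebraicGeometry.Hironaka2017
open Literature.AlgebraicGeometry.Hironaka2017.S02Preliminaries Literature.AlgebraicGeometry.Hironaka2017.S04CharAlgebra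
open Literature.AlgebraicGeometry.Hironaka2017.S06BaseHike Literature.AlgebraicGeometry.Hironaka2017.Datum
open Scheme.IdealSheafData

universe u

namespace CampaignW36

section OnClass

variable (𝒞 : ∀ ⦃W : Scheme.{u}⦄, IdealExponent W → Set W → Prop)
  (IsEdgeData : ∀ ⦃X : Scheme.{u}⦄ ⦃p n : ℕ⦄ (E : IdealExponent X) (ξ : X), EdgeDatumAt p n E ξ → Prop)
  (IsEdgeData' : ∀ ⦃X : Scheme.{u}⦄ ⦃p n : ℕ⦄ (E : IdealExponent X) (ξ : X), EdgeDatumAt p n E ξ → Prop)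

/-- **[OURS · L1 W3.6 ↔ R20 20a] `CampaignW36.Thm614Part1On 𝒞 IsEdgeData IsEdgeData'` — «Th. 6.14 (1) AT EVERY TYPED CORE FOCUS OF EVERY REALIZED
MEMBER OF THE CLASS»**: replaces the role of Th. 6.14 (1) p.34 l.11–17 read at the (43)-object on the class; NOT a statement of the manuscript. For every
standard `E` with `0 < Ê.b`, every family `ed` certified in the provenance `IsEdgeData`, if `𝒞 Ê Σ_max` then for EVERY `Ě` with
`IsCoreFocus_inst Ê Ě ed` the typed row-040a sentence `Thm6_14_1 A n IsCoreFocusOf E Ě hE hĚ (IsEdgeData' Ě)` holds, with the (unread) guard slot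
`IsCoreFocusOf := IsCoreFocus ℘ (invInst Ê ed)` and the READING `IsEdgeData'` of the produced edge data a parameter (R1 = `S04CharAlgebra.IsEdgeData`,
R2 = `IsEdgeData_alg`, or any reading implied by both — p493712's `hread`). A predicate on `(A, E, ed)` guarded by `𝒞`, universally closed: a
HYPOTHESIS row, never a modulus of record. [folklore] -/
def Thm614Part1On {p : ℕ} [Fact p.Prime] {K : Type u} [Field K] [CharP K p] [PerfectField K] (A : AmbientDatum p K) (n : ℕ) : Prop :=
  ∀ (E : IdealExponent A.Z) (ed : EdgeDataOn p n (baseHike E)) (hE : E.IsStandard), 0 < (baseHike E).b →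
    IsEdgeDataOn IsEdgeData (baseHike E) ed →
    𝒞 (baseHike E) (invmaxStratum ((baseHike E).sing ∩ S02Preliminaries.closedPoints A.Z) (invField (baseHike E) ed)) →
      ∀ (Echeck : IdealExponent A.Z) (hEc : IsCoreFocus_inst (baseHike E) Echeck ed),
        Thm6_14_1 A n (fun F G => IsCoreFocus S04CharAlgebra.pAlg (invInst (baseHike E) ed) F G) E Echeck hE hEc
          (IsEdgeData' Echeck)

variable {𝒞 IsEdgeData IsEdgeData'}

/-- **20a FOLLOWS, binder-free, on the class of REGULAR top strata** (res-adj-3 05:15:49Z (C), made literal): for ANY provenance `IsEdgeData` of the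
input family and ANY reading `IsEdgeData'` implied by R1 ∧ R2, `Thm614Part1On RegularClosureClass IsEdgeData IsEdgeData'` — p493712's
`Thm6_14_1_of_isRegular_sing` with its `hreg` supplied by p498576 §1. [folklore] -/
theorem thm614Part1On_regularClosureClass {p : ℕ} [Fact p.Prime] {K : Type u} [Field K] [CharP K p] [PerfectField K]
    {A : AmbientDatum p K} {n : ℕ}
    (hread : ∀ (F : IdealExponent A.Z) (η : A.Z) (D : EdgeDatumAt p n F η),
      S04CharAlgebra.IsEdgeData D → IsEdgeData_alg D → IsEdgeData' F η D) :
    Thm614Part1On RegularClosureClass IsEdgeData IsEdgeData' A n := by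
  intro E ed hE _ _ hC Echeck hEc
  exact Thm6_14_1_of_isRegular_sing A n IsEdgeData' hread _ E Echeck hE hEc ed hEc
    ((CampaignW31.invmaxClosureRegularOn_iff_isRegular_sing_of_isCoreFocus_inst A (baseHike E) ed hEc).mp hC)

/-- Antitonicity in the class. [folklore] -/
theorem thm614Part1On_mono {𝒟 : ∀ ⦃W : Scheme.{u}⦄, IdealExponent W → Set W → Prop}
    (hle : ∀ ⦃W⦄ (F : IdealExponent W) (S : Set W), 𝒞 F S → 𝒟 F S) {p : ℕ} [Fact p.Prime] {K : Type u} [Field K] [CharP K p]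
    [PerfectField K] {A : AmbientDatum p K} {n : ℕ} (h : Thm614Part1On 𝒟 IsEdgeData IsEdgeData' A n) :
    Thm614Part1On 𝒞 IsEdgeData IsEdgeData' A n :=
  fun E ed hE hb hed hC => h E ed hE hb hed (hle _ _ hC)

/-- On `HatClosureRegularOn 𝒞`-data (p498576) 20a holds on `𝒞`. [folklore] -/
theorem thm614Part1On_of_hatClosureRegularOn {p : ℕ} [Fact p.Prime] {K : Type u} [Field K] [CharP K p] [PerfectField K]
    {A : AmbientDatum p K} {n : ℕ}
    (hread : ∀ (F : IdealExponent A.Z) (η : A.Z) (D : EdgeDatumAt p n F η),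
      S04CharAlgebra.IsEdgeData D → IsEdgeData_alg D → IsEdgeData' F η D)
    (h : HatClosureRegularOn 𝒞 IsEdgeData A n) : Thm614Part1On 𝒞 IsEdgeData IsEdgeData' A n := by
  intro E ed hE hb hed hC Echeck hEc
  exact Thm6_14_1_of_isRegular_sing A n IsEdgeData' hread _ E Echeck hE hEc ed hEc
    ((CampaignW31.invmaxClosureRegularOn_iff_isRegular_sing_of_isCoreFocus_inst A (baseHike E) ed hEc).mp (h E ed hE hb hed hC))

end OnClass

end CampaignW36

open CampaignW36

/-- **[OURS · L1 W3.6 ↔ R20 20a] `CampaignW36Thm614Part1OnI 𝒞 p`** — `p`-slice of `Thm614Part1On 𝒞` at the input provenance of record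
`CampaignW31.edgeDataProvenance` (R1) with the PRODUCED edge data also read in R1 (`S04CharAlgebra.IsEdgeData`). HYPOTHESIS-shape class Prop (✓ on
`RegularClosureClass`, pre-declared ✗ on `LCIClass` at SEAT 1's cross); replaces the role of Th. 6.14 (1) read at the (43)-object on the class; NOT a
statement of the manuscript. [folklore] -/
def CampaignW36Thm614Part1OnI (𝒞 : ∀ ⦃W : Scheme.{u}⦄, IdealExponent W → Set W → Prop) (p : ℕ) [Fact p.Prime] : Prop :=
  ∀ (K : Type u) [Field K] [CharP K p] [PerfectField K] (A : AmbientDatum p K) (n : ℕ),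
    Thm614Part1On 𝒞 CampaignW31.edgeDataProvenance CampaignW31.edgeDataProvenance A n

/-- **[OURS · L1 W3.6 ↔ R20 20a, UNCONDITIONAL] 20a's FOLLOWS-half BY NAME, `p`-slice, R1 reading**: for every prime `p`, perfect `K`, ambient datum `A`,
`n`, standard `E` with `0 < Ê.b`, R1-certified `ed` whose `Σ̄_max(Ê)` is REGULAR, and EVERY typed core focus `Ě` (`IsCoreFocus_inst Ê Ě ed`): the typed
Th. 6.14 (1) sentence holds at `Ě` with its produced edge data read in R1. NOT a statement of the manuscript. [folklore] -/
theorem campaignW36Thm614Part1OnI_regularClosure_holds (p : ℕ) [Fact p.Prime] :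
    CampaignW36Thm614Part1OnI.{u} RegularClosureClass p :=
  fun _ _ _ _ _ _ => thm614Part1On_regularClosureClass fun _ _ _ hD _ => hD

/-- **[OURS · L1 W3.6 ↔ R20 20a] `CampaignW36Thm614Part1OnR2I 𝒞 p`** — the same slice with the PRODUCED edge data read in R2 (row 005 part d's
`IsEdgeData_alg`, via row 007g's `S04CharAlgebra.edgeDataProvenance_alg`); input provenance R1 as throughout the W3.x layer. HYPOTHESIS-shape class Prop;
NOT a statement of the manuscript. [folklore] -/
def CampaignW36Thm614Part1OnR2I (𝒞 : ∀ ⦃W : Scheme.{u}⦄, IdealExponent W → Set W → Prop) (p : ℕ) [Fact p.Prime] : Prop :=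
  ∀ (K : Type u) [Field K] [CharP K p] [PerfectField K] (A : AmbientDatum p K) (n : ℕ),
    Thm614Part1On 𝒞 CampaignW31.edgeDataProvenance S04CharAlgebra.edgeDataProvenance_alg A n

/-- **[UNCONDITIONAL] 20a's FOLLOWS-half, `p`-slice, R2 reading of the produced data.** [folklore] -/
theorem campaignW36Thm614Part1OnR2I_regularClosure_holds (p : ℕ) [Fact p.Prime] :
    CampaignW36Thm614Part1OnR2I.{u} RegularClosureClass p :=
  fun _ _ _ _ _ _ => thm614Part1On_regularClosureClass fun _ _ _ _ hDalg => hDalg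

/-- Either slice gives p498576's «`Ě` exists»-free statement nothing new, but on `HatClosureRegularOn 𝒞`-data (slice `CampaignW36HatClosureRegularOnI 𝒞 p`)
20a holds on `𝒞` in both readings. [folklore] -/
theorem campaignW36Thm614Part1OnI_of_hatClosureRegularOnI (𝒞 : ∀ ⦃W : Scheme.{u}⦄, IdealExponent W → Set W → Prop) (p : ℕ) [Fact p.Prime]
    (h : CampaignW36HatClosureRegularOnI.{u} 𝒞 p) :
    CampaignW36Thm614Part1OnI.{u} 𝒞 p ∧ CampaignW36Thm614Part1OnR2I.{u} 𝒞 p :=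
  ⟨fun K _ _ _ A n => thm614Part1On_of_hatClosureRegularOn (fun _ _ _ hD _ => hD) (h K A n),
    fun K _ _ _ A n => thm614Part1On_of_hatClosureRegularOn (fun _ _ _ _ hDalg => hDalg) (h K A n)⟩

/-- **Generic SEAT-1 composition (OFFER 05:14:53Z (1), AGREED by res-adj-3 05:18:01Z (B))**: on `LCIClass`-data (standard `E`, `0 < Ê.b`, certified `ed`), ANY property `P` refuted/held
for EVERY typed core focus (e.g. SEAT 1's `¬ Thm6_14_1 …` at the cross point) is witnessed by an ACTUAL `Ě` (door p491140) which moreover satisfies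
(56″) ∧ Th. 6.14 (2″) on every affine open (p499800). [folklore] -/
theorem exists_coreFocus_inst_of_lciClass (p : ℕ) [Fact p.Prime] (K : Type u) [Field K] [CharP K p] [PerfectField K]
    (A : AmbientDatum p K) (n : ℕ) (E : IdealExponent A.Z) (ed : EdgeDataOn p n (baseHike E)) (hE : E.IsStandard) (hb : 0 < (baseHike E).b)
    (hed : IsEdgeDataOn CampaignW31.edgeDataProvenance (baseHike E) ed)
    (hC : LCIClass (baseHike E) (invmaxStratum ((baseHike E).sing ∩ S02Preliminaries.closedPoints A.Z) (invField (baseHike E) ed)))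
    {P : IdealExponent A.Z → Prop} (hP : ∀ Echeck, IsCoreFocus_inst (baseHike E) Echeck ed → P Echeck) :
    ∃ Echeck : IdealExponent A.Z, IsCoreFocus_inst (baseHike E) Echeck ed ∧ P Echeck ∧
      ∀ V : A.Z.affineOpens, Eq56_prod_ours A Echeck V ∧ Thm6_14_prop2_prod_ours A Echeck V := by
  obtain ⟨Echeck, hEc, hV⟩ := campaignW36_eq56_thm614prop2_lci_holds p K A n E ed hE hb hed hC
  exact ⟨Echeck, hEc, hP Echeck hEc, hV⟩

end Summit.ResolutionOfSingularities.ResolutionOfSingularities.Theorems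

end
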